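import Mathlib
import HarnessLib
import Literature.NumberTheory.Automorphic.WeightOneDescent
import Literature.NumberTheory.Automorphic.NewformAdelisationCuspidal
import Literature.NumberTheory.Automorphic.BlockUnipotentDomains
import Summits.Langlands.Langlands.Theorems.QuarterDeficit1951CorrespondentFingerprintStubDescentAux2

/-!
# Crux `CorrespondentFingerprint` (stmt-Langlands-15898), line `Sketch`, stub `stub_descent`:
# auxiliary file 5 — the adelic cusp condition descends to the period integral at every cusp

For a `K₁(N)`-fixed cusp form `φ₀` on `GL₂(𝔸_ℚ)` of `SO(2)`-weight `0` killed by `Z`, with classical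
function `u(τ) = φ₀((g_τ, 1))`, and `g₀ ∈ SL₂(ℤ)`, `y > 0`: the adelic cusp condition
`∫_{ℚ\𝔸} φ₀(n(X) g) dX = 0` (`CuspConditionGL`) at `g = (g_{iy}, (g₀)_f⁻¹)`, over the box
`[0, N) × N ẑ` (a fundamental domain for `ℚ` in `𝔸_ℚ`, `isAddFundamentalDomain_box`), has integrand
`u(g₀ (x + iy))` as a function of the real coordinate `x` alone (`(g₀)_f n(t) (g₀)_f⁻¹ ∈ K(N) ≤ K₁(N)`
for `t ∈ N ẑ`), and the real marginal of a Haar measure over the strip is a NON-ZERO multiple of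
Lebesgue measure; hence `∫₀^N u(g₀(x + iy)) dx = 0` (registered sub-goal `stub_descent_cusp`).
Theorems only; no `sorry`.
-/

set_option linter.dupNamespace false

noncomputable section

open scoped MatrixGroups Matrix NumberField Classical NNReal ENNReal
open Literature.NumberTheory.Automorphic Literature.NumberTheory.GaloisRepresentations
  IsDedekindDomain NumberField MeasureTheory
open Literature.NumberTheory.Automorphic.GL2Real
open UpperHalfPlane Matrix.GeneralLinearGroup

namespace Summit.Langlands.Langlands.Theorems.CorrespondentFingerprint

/-! ### The conjugate unipotents `(g₀)_f n(t) (g₀)_f⁻¹`, `t ∈ N ẑ`, lie in `K₁(N)` -/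

section Conjugation

variable {N : ℕ}

/-- For `B ∈ SL₂(ℤ)` and `t ∈ N ẑ`, `B_f⁻¹ n(t) B_f ∈ K₁(N)` in `GL₂(𝔸_ℚ^∞)`
(`B⁻¹ n(t) B = 1 + t · B⁻¹ E₀₁ B` with `B⁻¹ E₀₁ B` integral). [cite: Gelbart1975, (3.2)–(3.5)] -/
theorem conj_upperRightHom_mem_gammaOneFiniteLevel (B : SL(2, ℤ)) {t : FiniteAdeleRing (𝓞 ℚ) ℚ}
    (ht : t ∈ levelIdeal ℚ (Ideal.span {(N : 𝓞 ℚ)})) :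
    (Matrix.GeneralLinearGroup.map (algebraMap ℚ (FiniteAdeleRing (𝓞 ℚ) ℚ)) (Matrix.SpecialLinearGroup.mapGL ℚ B))⁻¹ *
        upperRightHom t *
        Matrix.GeneralLinearGroup.map (algebraMap ℚ (FiniteAdeleRing (𝓞 ℚ) ℚ)) (Matrix.SpecialLinearGroup.mapGL ℚ B) ∈
      gammaOneFiniteLevel ℚ (Ideal.span {(N : 𝓞 ℚ)}) := by
  set φ := algebraMap ℚ (FiniteAdeleRing (𝓞 ℚ) ℚ) with hφ
  set γ : GL (Fin 2) ℚ := Matrix.SpecialLinearGroup.mapGL ℚ B with hγ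
  -- the conjugate `C = γ⁻¹ E₀₁ γ` has integer entries
  have hC : ∀ i j, ∃ z : ℤ, (((γ⁻¹ : GL (Fin 2) ℚ) : Matrix (Fin 2) (Fin 2) ℚ) * !![(0 : ℚ), 1; 0, 0] *
      (γ : Matrix (Fin 2) (Fin 2) ℚ)) i j = (z : ℚ) := by
    intro i j
    have h1 : ((γ⁻¹ : GL (Fin 2) ℚ) : Matrix (Fin 2) (Fin 2) ℚ) = ((B⁻¹ : SL(2, ℤ)) : Matrix (Fin 2) (Fin 2) ℤ).map (Int.castRingHom ℚ) := by
      rw [hγ, ← map_inv]; rfl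
    have h2 : (γ : Matrix (Fin 2) (Fin 2) ℚ) = (B : Matrix (Fin 2) (Fin 2) ℤ).map (Int.castRingHom ℚ) := rfl
    have h3 : (!![(0 : ℚ), 1; 0, 0] : Matrix (Fin 2) (Fin 2) ℚ) = (!![(0 : ℤ), 1; 0, 0]).map (Int.castRingHom ℚ) := by
      ext a b; fin_cases a <;> fin_cases b <;> simp
    refine ⟨(((B⁻¹ : SL(2, ℤ)) : Matrix (Fin 2) (Fin 2) ℤ) * !![(0 : ℤ), 1; 0, 0] * (B : Matrix (Fin 2) (Fin 2) ℤ)) i j, ?_⟩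
    rw [h1, h2, h3, ← Matrix.map_mul, ← Matrix.map_mul, Matrix.map_apply, eq_intCast]
  have hent : ∀ {s : FiniteAdeleRing (𝓞 ℚ) ℚ}, s ∈ levelIdeal ℚ (Ideal.span {(N : 𝓞 ℚ)}) →
      ∀ i j, ((((Matrix.GeneralLinearGroup.map φ γ)⁻¹ * upperRightHom s * Matrix.GeneralLinearGroup.map φ γ :
        GL (Fin 2) (FiniteAdeleRing (𝓞 ℚ) ℚ)) : Matrix (Fin 2) (Fin 2) (FiniteAdeleRing (𝓞 ℚ) ℚ)) i j -
          (1 : Matrix (Fin 2) (Fin 2) (FiniteAdeleRing (𝓞 ℚ) ℚ)) i j ∈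
        levelIdeal ℚ (Ideal.span {(N : 𝓞 ℚ)})) := by
    intro s hs i j
    obtain ⟨z, hz⟩ := hC i j
    rw [coe_map_inv_mul_upperRightHom_mul_map, add_sub_cancel_left, hz]
    exact mul_mem_levelIdeal' hs (algebraMap_intCast_mem_integralFiniteAdeles z)
  have hint : ∀ {s : FiniteAdeleRing (𝓞 ℚ) ℚ}, s ∈ levelIdeal ℚ (Ideal.span {(N : 𝓞 ℚ)}) →
      ∀ i j, ((((Matrix.GeneralLinearGroup.map φ γ)⁻¹ * upperRightHom s * Matrix.GeneralLinearGroup.map φ γ :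
        GL (Fin 2) (FiniteAdeleRing (𝓞 ℚ) ℚ)) : Matrix (Fin 2) (Fin 2) (FiniteAdeleRing (𝓞 ℚ) ℚ)) i j ∈
        integralFiniteAdeles ℚ) := by
    intro s hs i j
    have h := mem_integralFiniteAdeles_of_mem_levelIdeal (hent hs i j)
    have h1 : (1 : Matrix (Fin 2) (Fin 2) (FiniteAdeleRing (𝓞 ℚ) ℚ)) i j ∈ integralFiniteAdeles ℚ := by
      rw [Matrix.one_apply]; split_ifs <;> simp [one_mem, zero_mem]
    simpa using add_mem h h1
  have hinv : ((Matrix.GeneralLinearGroup.map φ γ)⁻¹ * upperRightHom t * Matrix.GeneralLinearGroup.map φ γ)⁻¹ =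
      (Matrix.GeneralLinearGroup.map φ γ)⁻¹ * upperRightHom (-t) * Matrix.GeneralLinearGroup.map φ γ := by
    rw [AddChar.map_neg_eq_inv]; group
  have ht' : -t ∈ levelIdeal ℚ (Ideal.span {(N : 𝓞 ℚ)}) := neg_mem ht
  rw [mem_gammaOneFiniteLevel_iff, mem_gammaZeroFiniteLevel_iff, mem_eichlerOrder_iff, mem_eichlerOrder_iff, hinv]
  refine ⟨⟨⟨hint ht, ?_⟩, hint ht', ?_⟩, ?_⟩
  · simpa [Matrix.one_apply_ne (show (1 : Fin 2) ≠ 0 by decide)] using hent ht 1 0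
  · simpa [Matrix.one_apply_ne (show (1 : Fin 2) ≠ 0 by decide)] using hent ht' 1 0
  · simpa [Matrix.one_apply_eq] using hent ht 1 1

end Conjugation

/-! ### The real marginal over the box is a non-zero multiple of Lebesgue measure -/

section Marginal

/-- The strip `{(X₀₁)_f ∈ M ẑ}` is open. [folklore] -/
theorem isOpen_strip (M : ℕ) : IsOpen (strip M : Set (blockNilpotent 2 1 (AdeleRing (𝓞 ℚ) ℚ))) :=
  (isOpen_levelIdeal _).preimage continuous_snd_blockEntry

/-- **The box has positive Haar measure** (it contains the non-empty open part of the strip over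
`(0, M)`). [folklore] -/
theorem measure_box_pos {M : ℕ} (hM : 0 < M) (ν : Measure (blockNilpotent 2 1 (AdeleRing (𝓞 ℚ) ℚ)))
    [ν.IsAddHaarMeasure] : 0 < ν (box M) := by
  have hU : IsOpen (realCoord ⁻¹' Set.Ioo (0 : ℝ) M ∩ (strip M : Set (blockNilpotent 2 1 (AdeleRing (𝓞 ℚ) ℚ)))) :=
    (isOpen_Ioo.preimage continuous_realCoord).inter (isOpen_strip M)
  have hne : (realCoord ⁻¹' Set.Ioo (0 : ℝ) M ∩ (strip M : Set (blockNilpotent 2 1 (AdeleRing (𝓞 ℚ) ℚ)))).Nonempty := by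
    refine ⟨blockOfRealFinite ((M : ℝ) / 2, 0), ?_, blockOfRealFinite_zero_mem_strip M _⟩
    rw [Set.mem_preimage, realCoord_blockOfRealFinite]
    have hMr : (0 : ℝ) < M := by exact_mod_cast hM
    exact ⟨by positivity, by linarith⟩
  refine lt_of_lt_of_le (hU.measure_pos ν hne) (measure_mono ?_)
  rw [box_eq]
  exact Set.inter_subset_inter_left _ (Set.preimage_mono Set.Ioo_subset_Ico_self)

/-- **From the box to the real period**: if `∫_{𝓑_M} H((X₀₁)_∞) dν = 0` for a continuous `H` and a
Haar measure `ν`, then `∫₀ᴹ H = 0` (the real marginal of `ν` over the strip is `c · Lebesgue` with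
`c ≠ 0`, as the box has positive finite measure). [folklore] -/
theorem intervalIntegral_eq_zero_of_setIntegral_box {M : ℕ} (hM : 0 < M)
    (ν : Measure (blockNilpotent 2 1 (AdeleRing (𝓞 ℚ) ℚ))) [ν.IsAddHaarMeasure] {H : ℝ → ℂ} (hH : Continuous H)
    (h0 : ∫ X in box M, H (realCoord X) ∂ν = 0) : ∫ u in (0 : ℝ)..M, H u = 0 := by
  obtain ⟨c, hc⟩ := exists_setIntegral_box_comp_realCoord M ν
  have h1 := hc H hH
  rw [h0] at h1
  have h2 := hc (fun _ => (1 : ℂ)) continuous_const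
  rw [setIntegral_const, intervalIntegral.integral_const, sub_zero] at h2
  have hpos : 0 < ν.real (box M) := ENNReal.toReal_pos (measure_box_pos hM ν).ne' (measure_box_lt_top M ν).ne
  have hc0 : (c : ℝ) ≠ 0 := by
    intro hc0
    rw [hc0, zero_smul] at h2
    have : (ν.real (box M) : ℂ) = 0 := by simpa using h2
    exact hpos.ne' (by exact_mod_cast this)
  rcases smul_eq_zero.1 h1.symm with h | h
  · exact absurd h hc0
  · exact h

end Marginal

/-! ### The period integral at the cusp `g₀ · ∞` -/

section Cusp

variable {hcpt : isCompact_glFiniteIntegralLevel 2 ℚ} {N : ℕ} [NeZero N]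
  {φ₀ : (AdelicGroupData.gl 2 ℚ).Adelic → ℂ}

omit [NeZero N] in
/-- `g_{x + z} = n(x) g_z` in `GL₂(ℝ)`. [folklore] -/
theorem upperHalfPlaneToGL_vadd (x : ℝ) (z : ℍ) :
    upperHalfPlaneToGL (x +ᵥ z) = upperRightHom x * upperHalfPlaneToGL z := by
  refine Units.ext ?_
  rw [Units.val_mul, coe_upperRightHom, GL2Real.coe_upperHalfPlaneToGL, GL2Real.coe_upperHalfPlaneToGL, GL2Real.secMat,
    GL2Real.secMat, coe_vadd]
  ext i j
  fin_cases i <;> fin_cases j <;> simp [Matrix.mul_apply, Fin.sum_univ_two, add_comm]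

omit [NeZero N] in
/-- `n(t) = (n(t_∞), 1) · (1, n(t_f))` in `GL₂(𝔸_ℚ)`. [folklore] -/
theorem upperRightHom_adele_eq (t : AdeleRing (𝓞 ℚ) ℚ) :
    (upperRightHom t : GL (Fin 2) (AdeleRing (𝓞 ℚ) ℚ)) =
      Rat.ofRealGL 2 (upperRightHom (Rat.infiniteAdeleRingEquivReal t.1)) * GLn.ofFinite 2 ℚ (upperRightHom t.2) := by
  conv_lhs => rw [← Rat.ofRealGL_archGL_mul_ofFinite_sndHom 2 (upperRightHom t)]
  rw [Rat.archGL_upperRightHom, Rat.sndHom_upperRightHom]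

omit [NeZero N] in
/-- `x ↦ x + z` is continuous `ℝ → ℍ`. [folklore] -/
theorem continuous_real_vadd (z : ℍ) : Continuous fun x : ℝ => x +ᵥ z := by
  refine UpperHalfPlane.isEmbedding_coe.continuous_iff.2 ?_
  have h : ((↑) : ℍ → ℂ) ∘ (fun x : ℝ => x +ᵥ z) = fun x : ℝ => (x : ℂ) + (z : ℂ) := by
    funext x; exact coe_vadd x z
  rw [h]
  exact Complex.continuous_ofReal.add continuous_const

/-- **Cuspidality of the weight-`0` descent at every cusp** (Gelbart 1975, Prop. 3.1 (vii), converse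
direction): for a `K₁(N)`-fixed cusp form `φ₀` on `GL₂(𝔸_ℚ)` of `SO(2)`-weight `0` killed by `Z`,
`u(τ) = φ₀((g_τ, 1))`, `g₀ ∈ SL₂(ℤ)` and `y > 0`, `∫₀ᴺ u(g₀ (x + iy)) dx = 0`: the adelic cusp
condition at `g = (g_{iy}, (g₀)_f⁻¹)` over the box `[0, N) × N ẑ`, whose integrand is
`u(g₀(x + iy))` as a function of the real coordinate (`(g₀)_f n(t) (g₀)_f⁻¹ ∈ K₁(N)` for `t ∈ N ẑ`),
and the non-vanishing of the real marginal. [cite: Gelbart1975, Prop. 3.1] [cite: BorelJacquet1979, 4.4] -/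
theorem descent_cuspidal (hcusp : φ₀ ∈ cuspFormsGL 2 ℚ hcpt)
    (hK : ∀ u ∈ gammaOneFiniteLevel ℚ (Ideal.span {(N : 𝓞 ℚ)}),
      rightTranslation (AdelicGroupData.gl 2 ℚ) (show (AdelicGroupData.gl 2 ℚ).Adelic from GLn.ofFinite 2 ℚ u) φ₀ = φ₀)
    (hs : IsArchSmooth Rat.iotaA φ₀) (hw : IsWeightVec Rat.iotaA 0 φ₀) (hZ : lieDeriv Rat.iotaA (toLie 1) φ₀ = 0)
    (g₀ : SL(2, ℤ)) {y : ℝ} (hy : 0 < y) :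
    ∫ x in (0 : ℝ)..(N : ℝ), φ₀ (Rat.ofRealGLA (upperHalfPlaneToGL
      (g₀ • UpperHalfPlane.ofComplex ((x : ℂ) + y * Complex.I)))) = 0 := by
  -- the base point `iy` and the horizontal line
  have hyI : 0 < ((y : ℂ) * Complex.I).im := by simpa using hy
  set zy : ℍ := ⟨(y : ℂ) * Complex.I, hyI⟩ with hzy
  have hpt : ∀ x : ℝ, UpperHalfPlane.ofComplex ((x : ℂ) + y * Complex.I) = x +ᵥ zy := fun x => by
    have hx : 0 < ((x : ℂ) + y * Complex.I).im := by simpa using hy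
    rw [ofComplex_apply_of_im_pos hx]
    apply UpperHalfPlane.ext
    rw [coe_vadd]
  -- the finite part of `g₀` and the adelic point `g = (g_{iy}, (g₀)_f⁻¹)`
  set k₀ : GL (Fin 2) (FiniteAdeleRing (𝓞 ℚ) ℚ) := GLn.sndHom 2 ℚ (GLn.ofGlobal 2 ℚ (Matrix.SpecialLinearGroup.mapGL ℚ g₀))
    with hk₀
  have hk₀' : k₀ = Matrix.GeneralLinearGroup.map (algebraMap ℚ (FiniteAdeleRing (𝓞 ℚ) ℚ))
      (Matrix.SpecialLinearGroup.mapGL ℚ g₀) := by rw [hk₀, Rat.sndHom_ofGlobal]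
  set Gy : (AdelicGroupData.gl 2 ℚ).Adelic :=
    (show GL (Fin 2) (AdeleRing (𝓞 ℚ) ℚ) from Rat.ofRealGL 2 (upperHalfPlaneToGL zy) * GLn.ofFinite 2 ℚ k₀⁻¹) with hGy
  set H : ℝ → ℂ := fun r => φ₀ (Rat.ofRealGL 2 (upperRightHom r * upperHalfPlaneToGL zy) * GLn.ofFinite 2 ℚ k₀⁻¹) with hHdef
  -- (1) `u(g₀ (r + iy)) = H(r)`
  have hH : ∀ r : ℝ, φ₀ (Rat.ofRealGLA (upperHalfPlaneToGL (g₀ • (r +ᵥ zy)))) = H r := fun r => by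
    have hdet : 0 < (Matrix.SpecialLinearGroup.mapGL ℝ g₀ * upperHalfPlaneToGL (r +ᵥ zy)).det.val := by
      rw [map_mul, Units.val_mul, Rat.det_mapGL_real, one_mul]; exact det_upperHalfPlaneToGL_pos _
    have hsmul : (Matrix.SpecialLinearGroup.mapGL ℝ g₀ * upperHalfPlaneToGL (r +ᵥ zy)) • UpperHalfPlane.I = g₀ • (r +ᵥ zy) := by
      rw [mul_smul, upperHalfPlaneToGL_smul_I]; rfl
    have h1 := apply_ofRealGL_eq hs hw hZ hdet
    rw [hsmul] at h1
    have e1 : Rat.ofRealGL 2 (Matrix.SpecialLinearGroup.mapGL ℝ g₀) =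
        GLn.ofGlobal 2 ℚ (Matrix.SpecialLinearGroup.mapGL ℚ g₀) * GLn.ofFinite 2 ℚ k₀⁻¹ := by
      rw [map_inv, Rat.ofGlobal_mapGL_eq g₀, ← hk₀, mul_inv_cancel_right]
    rw [← h1, map_mul, e1, mul_assoc, ← Rat.ofRealGL_mul_ofFinite_comm, apply_ofGlobal_mul_of_mem_cuspFormsGL hcusp,
      upperHalfPlaneToGL_vadd]
  -- (2) the integrand of the cusp condition on the box
  have hbox : ∀ X ∈ box N, φ₀ (glUnipotent 2 1 ℚ (Multiplicative.ofAdd X) * Gy) = H (realCoord X) := by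
    intro X hX
    have hX2 : (blockEntry X).2 ∈ levelIdeal ℚ (Ideal.span {(N : 𝓞 ℚ)}) := mem_strip_iff.1 ((box_eq N).le hX).2
    have hmem : k₀ * upperRightHom (blockEntry X).2 * k₀⁻¹ ∈ gammaOneFiniteLevel ℚ (Ideal.span {(N : 𝓞 ℚ)}) := by
      have h := conj_upperRightHom_mem_gammaOneFiniteLevel (N := N) g₀⁻¹ hX2
      rwa [map_inv, map_inv, ← hk₀', inv_inv] at h
    have e2 : (glUnipotent 2 1 ℚ (Multiplicative.ofAdd X) * Gy : (AdelicGroupData.gl 2 ℚ).Adelic) =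
        (show GL (Fin 2) (AdeleRing (𝓞 ℚ) ℚ) from
          Rat.ofRealGL 2 (upperRightHom (realCoord X) * upperHalfPlaneToGL zy) * GLn.ofFinite 2 ℚ k₀⁻¹ *
            GLn.ofFinite 2 ℚ (k₀ * upperRightHom (blockEntry X).2 * k₀⁻¹)) := by
      rw [hGy, show glUnipotent 2 1 ℚ (Multiplicative.ofAdd X) = (show (AdelicGroupData.gl 2 ℚ).Adelic from
        (upperRightHom (blockEntry X) : GL (Fin 2) (AdeleRing (𝓞 ℚ) ℚ))) from unipotentOfBlock_eq_upperRightHom X]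
      change (upperRightHom (blockEntry X) : GL (Fin 2) (AdeleRing (𝓞 ℚ) ℚ)) *
          (Rat.ofRealGL 2 (upperHalfPlaneToGL zy) * GLn.ofFinite 2 ℚ k₀⁻¹) = _
      rw [upperRightHom_adele_eq, realCoord_apply, map_mul (Rat.ofRealGL 2), map_mul (GLn.ofFinite 2 ℚ),
        map_mul (GLn.ofFinite 2 ℚ), map_inv, mul_assoc (Rat.ofRealGL 2 _), ← mul_assoc (GLn.ofFinite 2 ℚ (upperRightHom _)),
        ← Rat.ofRealGL_mul_ofFinite_comm]
      group
    rw [e2]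
    exact apply_mul_ofFinite_of_rightTranslation_eq hK _ hmem _
  -- (3) the adelic cusp condition over the box
  obtain ⟨-, hint⟩ := cuspConditionGL_of_mem_cuspFormsGL hcusp one_pos one_lt_two (blockHaar 2 1 ℚ) (box N)
    (isAddFundamentalDomain_box (NeZero.pos N) _) Gy
  rw [setIntegral_congr_fun (measurableSet_box N) hbox] at hint
  -- (4) continuity of `H` and the conclusion
  have hF : IsArchSmooth incl fun yy : GL (Fin 2) ℝ =>
      φ₀ ((show (AdelicGroupData.gl 2 ℚ).Adelic from GLn.ofFinite 2 ℚ k₀⁻¹) * Rat.ofRealGLA yy) :=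
    isArchSmooth_incl_of_inclOf hs _
  have hHc : Continuous H := by
    have e3 : H = (fun τ : ℍ => φ₀ ((show (AdelicGroupData.gl 2 ℚ).Adelic from GLn.ofFinite 2 ℚ k₀⁻¹) *
        Rat.ofRealGLA (upperHalfPlaneToGL τ))) ∘ fun r : ℝ => r +ᵥ zy := by
      funext r
      simp only [hHdef, Function.comp_apply]
      rw [← upperHalfPlaneToGL_vadd, Rat.ofRealGL_mul_ofFinite_comm]
      rfl
    rw [e3]
    exact (continuous_comp_upperHalfPlaneToGL hF).comp (continuous_real_vadd zy)
  have h0 := intervalIntegral_eq_zero_of_setIntegral_box (NeZero.pos N) (blockHaar 2 1 ℚ) hHc hint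
  rw [← h0]
  refine intervalIntegral.integral_congr fun x _ => ?_
  simp only [hpt, hH]

/-- **Registered sub-goal `stub_descent_cusp` of `stub_descent`** (closed form of `descent_cuspidal`):
the period-`N` integral of `u = φ₀((g_τ, 1))` vanishes on every horizontal line at every cusp
`g · ∞`, `g ∈ SL₂(ℤ)`. [cite: Gelbart1975, Prop. 3.1] -/
theorem stub_descent_cusp : ∀ (hcpt : isCompact_glFiniteIntegralLevel 2 ℚ) (N : ℕ) [NeZero N] (φ₀ : (AdelicGroupData.gl 2 ℚ).Adelic → ℂ), φ₀ ∈ cuspFormsGL 2 ℚ hcpt → (∀ u ∈ gammaOneFiniteLevel ℚ (Ideal.span {(N : 𝓞 ℚ)}), rightTranslation (AdelicGroupData.gl 2 ℚ) (show (AdelicGroupData.gl 2 ℚ).Adelic from GLn.ofFinite 2 ℚ u) φ₀ = φ₀) → IsArchSmooth Rat.iotaA φ₀ → IsWeightVec Rat.iotaA 0 φ₀ → lieDeriv Rat.iotaA (toLie 1) φ₀ = 0 → ∀ (g : Matrix.SpecialLinearGroup (Fin 2) ℤ) (y : ℝ), 0 < y → ∫ x in (0 : ℝ)..(N : ℝ),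 φ₀ (Rat.ofRealGLA (upperHalfPlaneToGL (g • UpperHalfPlane.ofComplex ((x : ℂ) + y * Complex.I)))) = 0 :=
  fun _ _ _ _ hcusp hK hs hw hZ g _ hy => descent_cuspidal hcusp hK hs hw hZ g hy

end Cusp

end Summit.Langlands.Langlands.Theorems.CorrespondentFingerprint
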